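import Summits.ResolutionOfSingularities.ResolutionOfSingularities.Theorems.FrobeniusLadderFRationalResolutionStalkIsoSpread
import Summits.ResolutionOfSingularities.ResolutionOfSingularities.Theorems.FrobeniusLadderFRationalResolutionGermEqLocal
import Summits.ResolutionOfSingularities.ResolutionOfSingularities.Theorems.FrobeniusLadderFRationalResolutionMutualInverseOpenImmersion
import HarnessLib

/-!
# Zariski-local recognition: isomorphic stalks give an open immersion of a neighbourhood

Support file for crux stmt-ResolutionOfSingularities-15317 (`FrobeniusLadder.FRationalResolution`),
line `Sketch`, continuation seat c3, cycle 9 (theme REC). For integral `k`-schemes `X`, `Y`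
locally of finite type and points `x ∈ X`, `y ∈ Y` with a `k`-compatible isomorphism of local
rings `e : 𝒪_{Y,y} ≅ 𝒪_{X,x}` (`Spec.map e.hom ≫ Y.fromSpecStalk y ≫ f_Y = X.fromSpecStalk x ≫ f_X`),
there is an open neighbourhood `x ∈ U ⊆ X` and an OPEN IMMERSION `j : U → Y` over `k` with
`j x = y`. Proof: spread `e` and `e⁻¹` out to morphisms `f : U₁ → Y`, `g : V₁ → X`
(`exists_nhd_hom_of_stalk_iso`, Stacks 0BX6); by germ uniqueness
(`exists_homOfLE_comp_eq_of_fromSpecStalkOfMem_comp_eq`) `g ∘ f` and `f ∘ g` are the inclusions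
near `x` and `y`; the formal lemma `isOpenImmersion_of_mutual_inverse` then cuts out an open on
which `f` is an open immersion. [cite: StacksProject, Tag 0BX6; folklore]
-/

-- single-problem summit: the doubled namespace component is forced
set_option linter.dupNamespace false

noncomputable section

namespace Summit.ResolutionOfSingularities.ResolutionOfSingularities.Theorems.FRationalResolution

open CategoryTheory AlgebraicGeometry TopologicalSpace

set_option backward.isDefEq.respectTransparency false in
/-- The germ map of a smaller open factors through the germ map of a larger one. -/
theorem fromSpecStalkOfMem_homOfLE {X : Scheme.{0}} {A U : X.Opens} (h : A ≤ U) (x : X)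
    (hxA : x ∈ A) :
    A.fromSpecStalkOfMem x hxA ≫ X.homOfLE h = U.fromSpecStalkOfMem x (h hxA) := by
  rw [← cancel_mono U.ι, Category.assoc, Scheme.homOfLE_ι, Scheme.Opens.fromSpecStalkOfMem_ι,
    Scheme.Opens.fromSpecStalkOfMem_ι]

/-- `Spec` of an isomorphism of stalks followed by `Spec` of its inverse is the identity. -/
theorem specMap_hom_specMap_inv {R S : CommRingCat.{0}} (e : R ≅ S) :
    Spec.map e.hom ≫ Spec.map e.inv = 𝟙 _ := by
  rw [← Spec.map_comp, Iso.inv_hom_id, Spec.map_id]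

/-- `Spec` of the inverse followed by `Spec` of the isomorphism is the identity. -/
theorem specMap_inv_specMap_hom {R S : CommRingCat.{0}} (e : R ≅ S) :
    Spec.map e.inv ≫ Spec.map e.hom = 𝟙 _ := by
  rw [← Spec.map_comp, Iso.hom_inv_id, Spec.map_id]

set_option backward.isDefEq.respectTransparency false in
/-- **One-sided step.** From a spread `f : U₁ → Y` of `e` at `x` (`f x = y`) and a spread
`g : V₁ → X` of `e⁻¹` at `y`: an open `x ∈ A₁ ≤ U₁` with `f(A₁) ⊆ V₁`, the restriction
`φ : A₁ → V₁` of `f`, and `g ∘ φ = ` the inclusion of `A₁`. -/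
theorem exists_restrict_comp_eq_ι {X Y : Scheme.{0}} [IsIntegral X] {x : X} {y : Y}
    (e : Y.presheaf.stalk y ≅ X.presheaf.stalk x) {U₁ : X.Opens} (hx₁ : x ∈ U₁)
    (f : (U₁ : Scheme.{0}) ⟶ Y) (eqf : Spec.map e.hom ≫ Y.fromSpecStalk y = U₁.fromSpecStalkOfMem x hx₁ ≫ f)
    (hfx : f.base ⟨x, hx₁⟩ = y) {V₁ : Y.Opens} (hy₁ : y ∈ V₁) (g : (V₁ : Scheme.{0}) ⟶ X)
    (eqg : Spec.map e.inv ≫ X.fromSpecStalk x = V₁.fromSpecStalkOfMem y hy₁ ≫ g) :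
    ∃ (A₁ : X.Opens) (hA : A₁ ≤ U₁) (φ : (A₁ : Scheme.{0}) ⟶ (V₁ : Scheme.{0})), x ∈ A₁ ∧
      φ ≫ V₁.ι = X.homOfLE hA ≫ f ∧ φ ≫ g = A₁.ι := by
  -- `A = U₁ ∩ f⁻¹(V₁)` as an open of `X`, and the restriction `φ₀ : A → V₁` of `f`
  set A : X.Opens := U₁.ι ''ᵁ (f ⁻¹ᵁ V₁) with hA_def
  have hA : A ≤ U₁ := U₁.ι_image_le _
  have hxV : f.base ⟨x, hx₁⟩ ∈ V₁ := by rw [hfx]; exact hy₁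
  have hxA : x ∈ A := ⟨⟨x, hx₁⟩, hxV, rfl⟩
  have hrange : Set.range (X.homOfLE hA ≫ f).base ⊆ Set.range V₁.ι.base := by
    rintro _ ⟨a, rfl⟩
    obtain ⟨w, hw, hwa⟩ := a.2
    have ha : X.homOfLE hA a = w := by
      apply Subtype.ext
      rw [Scheme.homOfLE_apply]
      exact hwa.symm
    rw [Scheme.Opens.range_ι]
    show f.base (X.homOfLE hA a) ∈ (V₁ : Set Y)
    rw [ha]
    exact hw
  set φ₀ : (A : Scheme.{0}) ⟶ (V₁ : Scheme.{0}) := IsOpenImmersion.lift V₁.ι (X.homOfLE hA ≫ f) hrange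
    with hφ₀_def
  have hφ₀ : φ₀ ≫ V₁.ι = X.homOfLE hA ≫ f := IsOpenImmersion.lift_fac _ _ _
  -- the germ of `φ₀` at `x` is `e` followed by the germ of `V₁` at `y`
  have hgerm : A.fromSpecStalkOfMem x hxA ≫ φ₀ = Spec.map e.hom ≫ V₁.fromSpecStalkOfMem y hy₁ := by
    rw [← cancel_mono V₁.ι, Category.assoc, Category.assoc, hφ₀, Scheme.Opens.fromSpecStalkOfMem_ι,
      ← Category.assoc, fromSpecStalkOfMem_homOfLE, ← eqf]
  -- hence `g ∘ φ₀` has the germ of the inclusion at `x`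
  have hab : A.fromSpecStalkOfMem x hxA ≫ (φ₀ ≫ g) = A.fromSpecStalkOfMem x hxA ≫ A.ι := by
    rw [← Category.assoc, hgerm, Category.assoc, ← eqg, ← Category.assoc, specMap_hom_specMap_inv,
      Category.id_comp, Scheme.Opens.fromSpecStalkOfMem_ι]
  obtain ⟨A₁, hA₁, hxA₁, hloc⟩ :=
    exists_homOfLE_comp_eq_of_fromSpecStalkOfMem_comp_eq A hxA (φ₀ ≫ g) A.ι hab
  refine ⟨A₁, hA₁.trans hA, X.homOfLE hA₁ ≫ φ₀, hxA₁, ?_, ?_⟩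
  · rw [Category.assoc, hφ₀, ← Category.assoc, Scheme.homOfLE_homOfLE]
  · rw [Category.assoc, hloc, Scheme.homOfLE_ι]

/-- **Zariski-local recognition.** Let `X`, `Y` be integral schemes locally of finite type over a
field `k`, `x ∈ X`, `y ∈ Y`, and `e : 𝒪_{Y,y} ≅ 𝒪_{X,x}` an isomorphism of local rings compatible
with the structure maps (`Spec.map e.hom ≫ Y.fromSpecStalk y ≫ f_Y = X.fromSpecStalk x ≫ f_X`).
Then some open neighbourhood `x ∈ U ⊆ X` admits an open immersion `j : U → Y` over `k` with
`j x = y`. [cite: StacksProject, Tag 0BX6; folklore] -/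
theorem exists_isOpenImmersion_nhd_of_stalk_iso (k : Type) [Field k] (X Y : Scheme.{0})
    [IsIntegral X] [IsIntegral Y] (fX : X ⟶ Spec (.of k)) (fY : Y ⟶ Spec (.of k))
    [LocallyOfFiniteType fX] [LocallyOfFiniteType fY] (x : X) (y : Y)
    (e : Y.presheaf.stalk y ≅ X.presheaf.stalk x)
    (he : Spec.map e.hom ≫ Y.fromSpecStalk y ≫ fY = X.fromSpecStalk x ≫ fX) :
    ∃ (U : X.Opens) (hxU : x ∈ U) (j : (U : Scheme.{0}) ⟶ Y), IsOpenImmersion j ∧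
      j.base ⟨x, hxU⟩ = y ∧ j ≫ fY = U.ι ≫ fX := by
  -- the compatibility for `e⁻¹`
  have he' : Spec.map e.symm.hom ≫ X.fromSpecStalk x ≫ fX = Y.fromSpecStalk y ≫ fY := by
    rw [Iso.symm_hom, ← he, ← Category.assoc, specMap_inv_specMap_hom, Category.id_comp]
  -- spread out `e` and `e⁻¹`
  obtain ⟨U₁, hx₁, f, eqf, hfk, hfx⟩ := exists_nhd_hom_of_stalk_iso k X Y fX fY x y e he
  obtain ⟨V₁, hy₁, g, eqg, hgk, hgy⟩ := exists_nhd_hom_of_stalk_iso k Y X fY fX y x e.symm he'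
  rw [Iso.symm_hom] at eqg
  -- `g ∘ f = ` inclusion near `x`, `f ∘ g = ` inclusion near `y`
  obtain ⟨A₁, hA, φ, hxA₁, hφ, h₁⟩ := exists_restrict_comp_eq_ι e hx₁ f eqf hfx hy₁ g eqg
  have eqf' : Spec.map e.symm.inv ≫ Y.fromSpecStalk y = U₁.fromSpecStalkOfMem x hx₁ ≫ f := by
    rw [Iso.symm_inv]; exact eqf
  have eqg' : Spec.map e.symm.hom ≫ X.fromSpecStalk x = V₁.fromSpecStalkOfMem y hy₁ ≫ g := by
    rw [Iso.symm_hom]; exact eqg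
  obtain ⟨B₁, hB, ψ, hyB₁, hψ, h₂⟩ := exists_restrict_comp_eq_ι e.symm hy₁ g eqg' hgy hx₁ f eqf'
  -- the formal step
  have hopen := isOpenImmersion_of_mutual_inverse U₁ A₁ V₁ B₁ hA hB f g φ ψ hφ hψ h₁ h₂
  set A₂ : X.Opens := A₁.ι ''ᵁ (φ ⁻¹ᵁ (V₁.ι ⁻¹ᵁ B₁)) with hA₂_def
  have hA₂ : A₂ ≤ A₁ := A₁.ι_image_le _
  -- `x ∈ A₂`: `φ x = f x = y ∈ B₁`
  have hφx : V₁.ι (φ ⟨x, hxA₁⟩) = y := by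
    have h := congrArg (fun t : (A₁ : Scheme.{0}) ⟶ Y => t ⟨x, hxA₁⟩) hφ
    simp only [Scheme.Hom.comp_apply] at h
    rw [h, Scheme.homOfLE_apply']
    exact hfx
  have hxA₂ : x ∈ A₂ := by
    refine ⟨⟨x, hxA₁⟩, ?_, rfl⟩
    show V₁.ι (φ ⟨x, hxA₁⟩) ∈ (B₁ : Set Y)
    rw [hφx]
    exact hyB₁
  refine ⟨A₂, hxA₂, X.homOfLE hA₂ ≫ φ ≫ V₁.ι, hopen, ?_, ?_⟩
  · -- the point
    show (X.homOfLE hA₂ ≫ φ ≫ V₁.ι) ⟨x, hxA₂⟩ = y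
    simp only [Scheme.Hom.comp_apply]
    rw [Scheme.homOfLE_apply']
    exact hφx
  · -- over `k`
    rw [Category.assoc, Category.assoc, ← Category.assoc φ, hφ, Category.assoc, hfk]
    simp only [Scheme.homOfLE_ι_assoc]

end Summit.ResolutionOfSingularities.ResolutionOfSingularities.Theorems.FRationalResolution

end
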